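import Summits.ValiantsHypothesis.ValiantsHypothesis.Theorems.KPlusLogSqLawTropicalBBoardLaw

/-!
# Route «KPlusLogSqLaw», crux `TropicalB` (stmt-ValiantsHypothesis-19771) — sequel of the BOARD LAW:
# (i) boards change only at steps touching the complementary pair, `n + 1 ≤ (m+1)·(H+1)`; (ii) the MULTI-BOARD LAW for any pairing of the classes

HONEST FRAMING.  Sequel of `…TropicalBBoardLaw` (seat val-sym-trop-p3 g18, cell `pub-symmetroid`, 2026-08-29; `--supports
stmt-ValiantsHypothesis-19771 --as helper`).  STRUCTURE laws for dominant chains of an ARBITRARY design (any format, exponents, valuations,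
support); part (i) is in the currency of the cell's `K = 4` fork, part (ii) holds for every `K` once the classes used are grouped into pairs.
Nothing here bounds `TropicalB` in its window; nothing bears on `WeakLifting`, DoorA26 / DoorA34, `MatrixDescartes` (stmt-ValiantsHypothesis-18050)
or VP ≠ VNP.

(i) BOARD-CHANGE LAW (four classes `a, b, c, e`; the `{a,b}`-board of a term = (columns of class `a` or `b`, their row image)).
* `BoardLaw.card_image_le_succ_card_changes` — a finite sequence takes at most (#change points) + 1 values. [folklore]
* `BoardLaw.board_eq_of_agree_high` — two terms agreeing (cell and class) at every column where either carries a class outside `{a,b}` have the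
  same `{a,b}`-board (low column sets agree by definition; row images agree because the images of the complement agree and permutations
  preserve complements, `BoardLaw.image_compl_perm`).
* `BoardLaw.succ_le_mul_succ_highSteps` — with `H` = #steps `k → k+1` changing a cell or class at a column that carries a class outside `{a,b}`
  before or after: the chain visits `≤ H + 1` boards, hence **`n + 1 ≤ (m + 1)·(H + 1)`** (board law: `m + 1` terms per board).  Between two
  consecutive steps touching the complementary pair, a four-class chain has at most `m + 1` terms.

(ii) MULTI-BOARD LAW (any number `r` of parts `{lo t, hi t}` of at most two classes, pairwise disjoint, covering the classes used by the chain;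
the MULTI-BOARD of a term = for every part, its column set and row image).
* `BoardLaw.card_filter_multiBoard_le` — **at most `m + 1` terms of a dominant chain share a multi-board**: inside a fibre every part is a
  restricted optimum with a common image, so every part-slope is weakly increasing in time (`IntervalOpt.sl_le_of_inOpt`) and strictly on a part
  where the terms differ (`IntervalOpt.sl_lt_of_inOpt`); the rank-sum of the part-slopes in their value sets (`≤ #T_t + 1` values each, two
  classes) is a strictly increasing potential bounded by `Σ_t #T_t = m`.
* `BoardLaw.succ_le_mul_card_multiBoards` — **`n + 1 ≤ (m + 1)·#{multi-boards visited}`**.  `r = 1` is `T(m,2) ≤ m`; `r = 2` is the board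
  law; for `K = 2r` classes paired as `{0,1}, {2,3}, …` it says that a long chain must keep re-distributing its columns (with their rows) among
  the class pairs: more than `(m+1)·X` terms force more than `X` multi-boards.

READING (located, nothing claimed).  For the fork: for EVERY split of the four classes into two pairs a cubic `(m,4)` family needs `Ω(m²)` steps
touching each pair while the other is «at work»; in the window of `TropicalB` a chain beyond the crux's budget re-partitions its columns among
class pairs super-quasi-polynomially often.  [this cell; comparison lemmas = the tree's `…TropicalBIntervalOpt` (folklore)]
-/

set_option linter.dupNamespace false
set_option autoImplicit false

namespace Summit.ValiantsHypothesis.ValiantsHypothesis.Theorems.KPlusLogSqLaw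

open Summit.ValiantsHypothesis.ValiantsHypothesis.Theorems.MatrixDescartes.Negative
open Summit.ValiantsHypothesis.ValiantsHypothesis.Theorems.LacunarySymmetroidMatrixDescartes
open scoped BigOperators
open Finset

namespace BoardLaw

variable {m K : ℕ}

/-- the number of distinct values of a finite sequence is at most one plus the number of places where it changes. [folklore] -/
theorem card_image_le_succ_card_changes {α : Type*} [DecidableEq α] {n : ℕ} (f : Fin (n + 1) → α) :
    (univ.image f).card ≤ (univ.filter fun k : Fin n => f k.castSucc ≠ f k.succ).card + 1 := by
  classical
  set S := insert (f 0) ((univ.filter fun k : Fin n => f k.castSucc ≠ f k.succ).image fun k => f k.succ) with hS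
  have hmem : ∀ j : Fin (n + 1), f j ∈ S := by
    intro j
    induction j using Fin.induction with
    | zero => exact mem_insert_self _ _
    | succ k ih =>
      by_cases h : f k.castSucc = f k.succ
      · rw [← h]; exact ih
      · exact mem_insert_of_mem (mem_image.2 ⟨k, mem_filter.2 ⟨mem_univ _, h⟩, rfl⟩)
  calc (univ.image f).card ≤ S.card := card_le_card fun x hx => by
          obtain ⟨j, -, rfl⟩ := mem_image.1 hx
          exact hmem j
    _ ≤ ((univ.filter fun k : Fin n => f k.castSucc ≠ f k.succ).image fun k => f k.succ).card + 1 := card_insert_le _ _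
    _ ≤ (univ.filter fun k : Fin n => f k.castSucc ≠ f k.succ).card + 1 := Nat.add_le_add_right card_image_le 1

/-- **Low steps keep the board.**  If two terms agree (cell and class) at every column at which either of them carries a class outside
`{a, b}`, then they have the same `{a,b}`-board (same low columns, same row image). [this cell] -/
theorem board_eq_of_agree_high (a b : Fin K) (q q' : Equiv.Perm (Fin m) × (Fin m → Fin K))
    (h : ∀ i, (¬ (q.2 i = a ∨ q.2 i = b) ∨ ¬ (q'.2 i = a ∨ q'.2 i = b)) → q.1 i = q'.1 i ∧ q.2 i = q'.2 i) :
    ((univ.filter fun i => q.2 i = a ∨ q.2 i = b), (univ.filter fun i => q.2 i = a ∨ q.2 i = b).image q.1) =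
      ((univ.filter fun i => q'.2 i = a ∨ q'.2 i = b), (univ.filter fun i => q'.2 i = a ∨ q'.2 i = b).image q'.1) := by
  classical
  have hT : (univ.filter fun i => q.2 i = a ∨ q.2 i = b) = (univ.filter fun i => q'.2 i = a ∨ q'.2 i = b) := by
    ext i
    simp only [mem_filter, mem_univ, true_and]
    constructor
    · intro hi
      by_contra hi'
      have := (h i (Or.inr hi')).2
      rw [this] at hi
      exact hi' hi
    · intro hi'
      by_contra hi
      have := (h i (Or.inl hi)).2
      rw [← this] at hi'
      exact hi hi'
  set T := univ.filter fun i => q.2 i = a ∨ q.2 i = b with hTdef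
  -- off `T` the two terms agree, so the images of `Tᶜ` coincide, hence the images of `T`
  have hC : Tᶜ.image q.1 = Tᶜ.image q'.1 := by
    apply image_congr
    intro i hi
    have hi' : ¬ (q.2 i = a ∨ q.2 i = b) := fun hh => (mem_compl.1 (mem_coe.1 hi)) (mem_filter.2 ⟨mem_univ _, hh⟩)
    exact (h i (Or.inl hi')).1
  have hI : T.image q.1 = T.image q'.1 := by
    have h1 := image_compl_perm q.1 T
    have h2 := image_compl_perm q'.1 T
    have : (T.image q.1)ᶜ = (T.image q'.1)ᶜ := by rw [← h1, ← h2, hC]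
    exact compl_injective this
  rw [Prod.mk.injEq]
  exact ⟨hT, hT ▸ hI⟩

section Chain

variable (d : Fin K → ℕ) (v ε : Fin m → Fin m → Fin K → ℤ) {n : ℕ} (θ : Fin (n + 1) → ℤ)
  (p : Fin (n + 1) → Equiv.Perm (Fin m) × (Fin m → Fin K))

/-- **BOARD-CHANGE LAW.**  Along a dominant chain on four classes `a, b, c, e` (strictly increasing integer slopes, consecutive terms distinct),
let `H` be the number of steps `k → k+1` that change a cell or a class at some column carrying a class outside `{a, b}` before or after
(«steps touching the complementary pair»).  Then the chain visits at most `H + 1` boards of the pair `{a,b}`, so **`n + 1 ≤ (m + 1)·(H + 1)`**: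
between two consecutive steps touching the complementary pair, at most `m + 1` terms. [this cell] -/
theorem succ_le_mul_succ_highSteps (hθ : StrictMono θ) (hdom : ∀ k, IsDominant d v ε (θ k) (p k))
    (hne : ∀ k : Fin n, p k.castSucc ≠ p k.succ) (a b c e : Fin K)
    (hcov : ∀ k i, (p k).2 i = a ∨ (p k).2 i = b ∨ (p k).2 i = c ∨ (p k).2 i = e) :
    n + 1 ≤ (m + 1) * ((univ.filter fun k : Fin n => ∃ i,
        (¬ ((p k.castSucc).2 i = a ∨ (p k.castSucc).2 i = b) ∨ ¬ ((p k.succ).2 i = a ∨ (p k.succ).2 i = b)) ∧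
        ((p k.castSucc).1 i ≠ (p k.succ).1 i ∨ (p k.castSucc).2 i ≠ (p k.succ).2 i)).card + 1) := by
  classical
  set brd : Fin (n + 1) → Finset (Fin m) × Finset (Fin m) := fun k => ((univ.filter fun i => (p k).2 i = a ∨ (p k).2 i = b),
        (univ.filter fun i => (p k).2 i = a ∨ (p k).2 i = b).image (p k).1) with hbrd
  have h1 := succ_le_mul_card_boards d v ε θ p hθ hdom hne a b c e hcov
  have h2 := card_image_le_succ_card_changes brd
  -- a board change is a step touching the complementary pair
  have h3 : (univ.filter fun k : Fin n => brd k.castSucc ≠ brd k.succ).card ≤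
      (univ.filter fun k : Fin n => ∃ i,
        (¬ ((p k.castSucc).2 i = a ∨ (p k.castSucc).2 i = b) ∨ ¬ ((p k.succ).2 i = a ∨ (p k.succ).2 i = b)) ∧
        ((p k.castSucc).1 i ≠ (p k.succ).1 i ∨ (p k.castSucc).2 i ≠ (p k.succ).2 i)).card := by
    refine card_le_card fun k hk => ?_
    rw [mem_filter] at hk ⊢
    refine ⟨mem_univ _, ?_⟩
    by_contra hno
    apply hk.2
    refine board_eq_of_agree_high a b (p k.castSucc) (p k.succ) fun i hi => ?_
    by_contra hc
    exact hno ⟨i, hi, by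
      by_cases h1 : (p k.castSucc).1 i = (p k.succ).1 i
      · exact Or.inr fun h2 => hc ⟨h1, h2⟩
      · exact Or.inl h1⟩
  calc n + 1 ≤ (m + 1) * (univ.image brd).card := h1
    _ ≤ (m + 1) * ((univ.filter fun k : Fin n => brd k.castSucc ≠ brd k.succ).card + 1) := Nat.mul_le_mul_left _ h2
    _ ≤ _ := Nat.mul_le_mul_left _ (Nat.add_le_add_right h3 1)

end Chain

end BoardLaw

end Summit.ValiantsHypothesis.ValiantsHypothesis.Theorems.KPlusLogSqLaw


namespace Summit.ValiantsHypothesis.ValiantsHypothesis.Theorems.KPlusLogSqLaw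

open Summit.ValiantsHypothesis.ValiantsHypothesis.Theorems.MatrixDescartes.Negative
open Summit.ValiantsHypothesis.ValiantsHypothesis.Theorems.LacunarySymmetroidMatrixDescartes
open scoped BigOperators
open Finset

namespace BoardLaw

variable {m K r : ℕ}

section Pairing

variable (d : Fin K → ℕ) (v ε : Fin m → Fin m → Fin K → ℤ) {n : ℕ} (θ : Fin (n + 1) → ℤ)
  (p : Fin (n + 1) → Equiv.Perm (Fin m) × (Fin m → Fin K)) (lo hi : Fin r → Fin K)

/-- **MULTI-BOARD LAW (fibre form).**  Let the classes used by a dominant chain (strictly increasing integer slopes, consecutive terms distinct)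
be covered by `r` parts `{lo t, hi t}` of at most two classes each, pairwise disjoint.  The MULTI-BOARD of a term assigns to every part `t` the set
`T_t` of columns carrying a class of the part together with its row image.  Then **at most `m + 1` terms of the chain share a multi-board**:
inside such a fibre every part is a restricted optimum with a common image, so each part-slope is weakly increasing in time
(`IntervalOpt.sl_le_of_inOpt`) and strictly on a part where the terms differ (`IntervalOpt.sl_lt_of_inOpt`); the rank-sum of the part-slopes
inside their value sets (`≤ #T_t + 1` values, two classes per part) is a strictly increasing potential bounded by `Σ_t #T_t = m`. [this cell] -/
theorem card_filter_multiBoard_le (hθ : StrictMono θ) (hdom : ∀ k, IsDominant d v ε (θ k) (p k))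
    (hne : ∀ k : Fin n, p k.castSucc ≠ p k.succ)
    (hcov : ∀ k i, ∃ t, (p k).2 i = lo t ∨ (p k).2 i = hi t)
    (hdisj : ∀ t t' (l : Fin K), (l = lo t ∨ l = hi t) → (l = lo t' ∨ l = hi t') → t = t')
    (β : Fin r → Finset (Fin m) × Finset (Fin m)) :
    (univ.filter fun k => (fun t => ((univ.filter fun i => (p k).2 i = lo t ∨ (p k).2 i = hi t),
        (univ.filter fun i => (p k).2 i = lo t ∨ (p k).2 i = hi t).image (p k).1)) = β).card ≤ m + 1 := by
  classical
  set Tp : Fin (n + 1) → Fin r → Finset (Fin m) := fun k t => univ.filter fun i => (p k).2 i = lo t ∨ (p k).2 i = hi t with hTp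
  set F := univ.filter fun k => (fun t => (Tp k t, (Tp k t).image (p k).1)) = β with hF
  show F.card ≤ m + 1
  -- data of the fibre
  have hmem : ∀ k ∈ F, ∀ t, Tp k t = (β t).1 ∧ (β t).1.image (p k).1 = (β t).2 := by
    intro k hk t
    have h := congrFun (mem_filter.1 hk).2 t
    have h1 : Tp k t = (β t).1 := congrArg Prod.fst h
    refine ⟨h1, ?_⟩
    have h2 := congrArg Prod.snd h
    rw [h1] at h2
    exact h2
  have hcls : ∀ k ∈ F, ∀ t, ∀ i ∈ (β t).1, (p k).2 i = lo t ∨ (p k).2 i = hi t := by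
    intro k hk t i hi
    rw [← (hmem k hk t).1] at hi
    exact (mem_filter.1 hi).2
  -- the parts cover the columns and are pairwise disjoint (for members of the fibre)
  have hcover : ∀ k ∈ F, ∀ i, ∃ t, i ∈ (β t).1 := by
    intro k hk i
    obtain ⟨t, ht⟩ := hcov k i
    exact ⟨t, by rw [← (hmem k hk t).1]; exact mem_filter.2 ⟨mem_univ _, ht⟩⟩
  have hpd : ∀ k ∈ F, ∀ t t', t ≠ t' → Disjoint (β t).1 (β t').1 := by
    intro k hk t t' htt'
    rw [← (hmem k hk t).1, ← (hmem k hk t').1, Finset.disjoint_left]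
    intro i hi hi'
    exact htt' (hdisj t t' ((p k).2 i) (mem_filter.1 hi).2 (mem_filter.1 hi').2)
  -- if the fibre is empty there is nothing to prove
  rcases F.eq_empty_or_nonempty with hF0 | ⟨k₀, hk₀⟩
  · rw [hF0, card_empty]; exact Nat.zero_le _
  have hsum : ∑ t, (β t).1.card ≤ m := by
    have h := card_biUnion (s := (univ : Finset (Fin r))) (t := fun t => (β t).1)
      (fun t _ t' _ htt' => hpd k₀ hk₀ t t' htt')
    rw [← h]
    exact (card_le_univ _).trans (Fintype.card_fin m).le
  -- restricted optima and common images
  have hopt : ∀ k (J : Finset (Fin m)), IntervalOpt.InOpt d v ε J (θ k) (p k) := fun k J =>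
    IntervalOpt.inOpt_mono (subset_univ J) (IntervalOpt.inOpt_univ_of_isDominant (hdom k))
  have himg : ∀ k ∈ F, ∀ k' ∈ F, ∀ t, (β t).1.image (p k).1 = (β t).1.image (p k').1 := fun k hk k' hk' t => by
    rw [(hmem k hk t).2, (hmem k' hk' t).2]
  -- value sets and the potential
  set A : Fin r → Finset ℤ := fun t => (range ((β t).1.card + 1)).image
      (fun j : ℕ => ((β t).1.card : ℤ) * d (lo t) + (j : ℤ) * ((d (hi t) : ℤ) - d (lo t))) with hA
  have hslA : ∀ k ∈ F, ∀ t, IntervalOpt.sl d (β t).1 (p k) ∈ A t := fun k hk t =>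
    sl_mem_image_of_two d (lo t) (hi t) (β t).1 (p k) (hcls k hk t)
  set Φ : Fin (n + 1) → ℕ := fun k => ∑ t, ((A t).filter (· < IntervalOpt.sl d (β t).1 (p k))).card with hΦ
  -- the potential is bounded by `m`
  have hΦle : ∀ k ∈ F, Φ k ≤ m := by
    intro k hk
    refine le_trans (sum_le_sum fun t _ => ?_) hsum
    have hss : (A t).filter (· < IntervalOpt.sl d (β t).1 (p k)) ⊂ A t :=
      (ssubset_iff_of_subset (filter_subset _ _)).2 ⟨_, hslA k hk t, by rw [mem_filter]; exact fun h => lt_irrefl _ h.2⟩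
    have h1 := card_lt_card hss
    have h2 : (A t).card ≤ (β t).1.card + 1 := card_image_two_le d (lo t) (hi t) (β t).1
    omega
  -- the potential strictly increases along the fibre
  have hslope := slope_strictMono_of_chainD d v ε θ p hθ hdom hne
  have hΦlt : ∀ k ∈ F, ∀ k' ∈ F, k < k' → Φ k < Φ k' := by
    intro k hk k' hk' hkk'
    -- some part differs
    have hdiff : ∃ t, IntervalOpt.restr (β t).1 (p k) ≠ IntervalOpt.restr (β t).1 (p k') := by
      by_contra hall
      push Not at hall
      apply (hslope.injective.ne (ne_of_lt hkk'))
      show TropicalCensus.slope d (p k) = TropicalCensus.slope d (p k')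
      have hpp : p k = p k' := by
        refine Prod.ext (Equiv.ext fun i => ?_) (funext fun i => ?_)
        · obtain ⟨t, hit⟩ := hcover k hk i
          have := IntervalOpt.restr_eq_iff.1 (hall t) i hit
          exact this.1
        · obtain ⟨t, hit⟩ := hcover k hk i
          have := IntervalOpt.restr_eq_iff.1 (hall t) i hit
          exact this.2
      rw [hpp]
    obtain ⟨t₀, ht₀⟩ := hdiff
    have hle : ∀ t, ((A t).filter (· < IntervalOpt.sl d (β t).1 (p k))).card ≤
        ((A t).filter (· < IntervalOpt.sl d (β t).1 (p k'))).card := by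
      intro t
      refine card_le_card fun x hx => ?_
      rw [mem_filter] at hx ⊢
      exact ⟨hx.1, lt_of_lt_of_le hx.2
        (IntervalOpt.sl_le_of_inOpt (hopt k _) (hopt k' _) (himg k hk k' hk' t) (hθ hkk').le)⟩
    have hlt : ((A t₀).filter (· < IntervalOpt.sl d (β t₀).1 (p k))).card <
        ((A t₀).filter (· < IntervalOpt.sl d (β t₀).1 (p k'))).card := by
      refine card_lt_card ((ssubset_iff_of_subset fun x hx => ?_).2 ⟨IntervalOpt.sl d (β t₀).1 (p k), ?_, ?_⟩)
      · rw [mem_filter] at hx ⊢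
        exact ⟨hx.1, lt_of_lt_of_le hx.2
          (IntervalOpt.sl_le_of_inOpt (hopt k _) (hopt k' _) (himg k hk k' hk' t₀) (hθ hkk').le)⟩
      · rw [mem_filter]
        exact ⟨hslA k hk t₀, IntervalOpt.sl_lt_of_inOpt (hopt k _) (hopt k' _) (himg k hk k' hk' t₀) (hθ hkk') ht₀⟩
      · rw [mem_filter]; exact fun h => lt_irrefl _ h.2
    calc Φ k = ∑ t, ((A t).filter (· < IntervalOpt.sl d (β t).1 (p k))).card := rfl
      _ < ∑ t, ((A t).filter (· < IntervalOpt.sl d (β t).1 (p k'))).card :=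
          sum_lt_sum (fun t _ => hle t) ⟨t₀, mem_univ _, hlt⟩
  -- conclude: Φ is injective on the fibre with values in `[0, m]`
  have hinj : Set.InjOn Φ F := by
    intro k hk k' hk' h
    by_contra hkk
    rcases lt_or_gt_of_ne hkk with hlt | hlt
    · exact absurd h (hΦlt k hk k' hk' hlt).ne
    · exact absurd h.symm (hΦlt k' hk' k hk hlt).ne
  calc F.card = (F.image Φ).card := (card_image_of_injOn hinj).symm
    _ ≤ (range (m + 1)).card := card_le_card fun x hx => by
        obtain ⟨k, hk, rfl⟩ := mem_image.1 hx
        exact mem_range.2 (Nat.lt_succ_of_le (hΦle k hk))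
    _ = m + 1 := card_range _

/-- **MULTI-BOARD LAW.**  Under the same hypotheses, `n + 1 ≤ (m + 1) · N`, `N` = number of distinct multi-boards visited by the chain.
For `r = 1` (two classes) this is `T(m,2) ≤ m`; for two pairs it is the board law of `…TropicalBBoardLaw`. [this cell] -/
theorem succ_le_mul_card_multiBoards (hθ : StrictMono θ) (hdom : ∀ k, IsDominant d v ε (θ k) (p k))
    (hne : ∀ k : Fin n, p k.castSucc ≠ p k.succ)
    (hcov : ∀ k i, ∃ t, (p k).2 i = lo t ∨ (p k).2 i = hi t)
    (hdisj : ∀ t t' (l : Fin K), (l = lo t ∨ l = hi t) → (l = lo t' ∨ l = hi t') → t = t') :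
    n + 1 ≤ (m + 1) * (univ.image fun k : Fin (n + 1) => fun t => ((univ.filter fun i => (p k).2 i = lo t ∨ (p k).2 i = hi t),
        (univ.filter fun i => (p k).2 i = lo t ∨ (p k).2 i = hi t).image (p k).1)).card := by
  classical
  set mb : Fin (n + 1) → (Fin r → Finset (Fin m) × Finset (Fin m)) := fun k t =>
    ((univ.filter fun i => (p k).2 i = lo t ∨ (p k).2 i = hi t),
      (univ.filter fun i => (p k).2 i = lo t ∨ (p k).2 i = hi t).image (p k).1) with hmb
  have hfib : ∀ β ∈ univ.image mb, (univ.filter fun k => mb k = β).card ≤ m + 1 := fun β _ =>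
    card_filter_multiBoard_le d v ε θ p lo hi hθ hdom hne hcov hdisj β
  have hsum := card_eq_sum_card_image mb (univ : Finset (Fin (n + 1)))
  have hle : ∑ β ∈ univ.image mb, (univ.filter fun k => mb k = β).card ≤ (univ.image mb).card * (m + 1) :=
    (sum_le_card_nsmul _ _ _ hfib).trans (by rw [smul_eq_mul])
  have hcard : (univ : Finset (Fin (n + 1))).card = n + 1 := by rw [card_univ, Fintype.card_fin]
  calc n + 1 = (univ : Finset (Fin (n + 1))).card := hcard.symm
    _ = ∑ β ∈ univ.image mb, (univ.filter fun k => mb k = β).card := hsum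
    _ ≤ (univ.image mb).card * (m + 1) := hle
    _ = (m + 1) * (univ.image mb).card := mul_comm _ _

end Pairing

end BoardLaw

end Summit.ValiantsHypothesis.ValiantsHypothesis.Theorems.KPlusLogSqLaw
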